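import Mathlib.Topology.Compactification.OnePoint.ProjectiveLine
import Mathlib.NumberTheory.Padics.PadicVal.Basic
import Mathlib.NumberTheory.ModularForms.CongruenceSubgroups
import Literature.LinearAlgebra.Matrix.SpecialLinearReductionSurjective
import HarnessLib

/-!
# Ihara's amalgam `Γ̃(N) = Γ(N) *_{Γ(N) ∩ Γ₀(p)} A⁻¹ Γ(N) A ≤ SL₂(ℤ[1/p])` — I: ping-pong on `ℙ¹(ℚ)`

Topic `Literature/GroupTheory/ArithmeticGroups`; namespace
`Literature.GroupTheory.ArithmeticGroups.IharaAmalgam`.  PROOF-ONLY file (no definition, no named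
fact; D-0026): the INJECTIVITY half of Ihara's theorem [Ihara1966DiscreteSubgroups; Serre, *Trees*,
II.1.4 Theorem 3 and Corollary 1]: for a prime `p ∤ N` and `A = diag(p, 1)`, the subgroups
`K₀ = Γ(N)` and `K₁ = A⁻¹ Γ(N) A` of `GL₂(ℚ)` (both in `SL₂(ℤ[1/p])`) generate their free product
amalgamated over `K₀ ∩ K₁ = Γ(N) ∩ Γ₀(p)`: every non-empty reduced alternating word in `K₀`, `K₁`
has product `≠ 1` (`prod_ne_one_of_reduced`).  The universal property (file II,
`IharaAmalgamLift.lean`) and the generation of the level-`N` congruence subgroup of `SL₂(ℤ[1/p])`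
by `K₀ ∪ K₁` (file III) follow; together with the tree's PROVED congruence subgroup property of
`SL₂(ℤ[1/p])` (`SerreSL2Congruence1970_congruenceSubgroupProperty_away_holds`) they give the
"amalgam + CSP" sentence consumed by the Calegari–Dimitrov–Tang formalisation
(`CalegariDimitrovTang2025_unboundedDenominators.of_two_inputs`, hypothesis `hker₂` = CDT Lemma
4.4.1 / 4.6.2, Ihara's lemma in Ribet's form).

## The proof (Serre's tree, flattened to a ping-pong)

Serre proves the amalgam by letting `SL₂(ℤ[1/p])` act on the Bruhat–Tits tree of `SL₂(ℚ_p)` with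
an edge as fundamental domain (Trees II.1.4) and invoking the structure theorem I.4.1 Thm. 6, whose
injectivity half is a ping-pong on the two half-trees cut out by the edge.  We run that ping-pong
directly on the boundary `ℙ¹(ℚ) ⊂ ℙ¹(ℚ_p)` (Mathlib's `OnePoint ℚ` with the Möbius action of
`GL (Fin 2) ℚ`): the half-tree containing the vertex `ℤ_p²` has boundary the `p`-INTEGRAL points
`X = {t : v_p(t) ≥ 0}`, the other half-tree the complement `{∞} ∪ {t : v_p(t) < 0}`.
* `pingPong_smul_mem`, `pingPong_prod_ne_one_of_fst_eq`, `pingPong_prod_ne_one` — the abstract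
  ping-pong lemma for two subgroups `K false, K true ≤ Γ` acting on `Ω` with disjoint non-empty
  `X false, X true`, `K i ∖ K (!i)` mapping `X (!i)` into `X i`, and three cosets of the edge group
  in each `K i` (to conjugate an even-length word into an odd-length one)
  [LyndonSchupp1977, IV.2; Serre1980Trees, I.4.1];
* `mapGL_smul_mem_of_not_dvd` (PING: `γ ∈ SL₂(ℤ)` with `p ∤ γ₁₀` maps `Xᶜ` into `X`),
  `conj_mapGL_smul_not_mem_of_not_dvd` (PONG: `A⁻¹ γ A` with `p ∤ γ₀₁` maps `X` into `Xᶜ`) — two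
  valuation estimates (`le_padicValRat_add`, `padicValRat_add_eq_of_lt`);
* `exists_mem_Gamma_diag_mul_eq` / `exists_mem_Gamma_mapGL_mul_diag_eq` / `dvd_of_diag_mul_mapGL_eq`
  (`A (Γ(N) ∩ Γ₀(p)) A⁻¹ = Γ(N) ∩ Γ⁰(p)`, so `K₀ ∩ K₁ = Γ(N) ∩ Γ₀(p)`: `mapGL_mem_iff_dvd`,
  `conj_mapGL_mem_iff_dvd`, `mem_iff_exists_conj`), `exists_mem_Gamma_forall_dvd_sub` (strong
  approximation `Γ(N) ↠ SL₂(ℤ/p)`, from the tree's `IntegerSpecialLinear.exists_specialLinearGroup_intModEq`),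
  `exists_mul_not_mem_right/left` (three cosets: `[K_i : K₀ ∩ K₁] = p + 1 ≥ 3`);
* `prod_ne_one_of_reduced` — the theorem.
The vertex groups are carried in HYPOTHESIS FORM (`hK₀ : g ∈ K₀ ↔ ∃ γ ∈ Γ(N), mapGL ℚ γ = g`,
`hK₁ : g ∈ K₁ ↔ A g A⁻¹ ∈ K₀`, `hA : A = !![p, 0; 0, 1]`) so that no definition is introduced.

## References

* [Ihara1966DiscreteSubgroups] Y. Ihara, On discrete subgroups of the two by two projective linear
  group over 𝔭-adic fields, J. Math. Soc. Japan 18 (1966) 219–235 (the amalgam for `SL₂(ℤ[1/p])`).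
* [Serre1980Trees] J.-P. Serre, *Trees*, Springer 1980, I.4.1 Thm. 6 (structure theorem / ping-pong),
  II.1.4 Thm. 3 and Cor. 1 (`SL₂(ℤ[1/p]) = SL₂(ℤ) *_{Γ₀(p)} SL₂(ℤ)`, and for congruence subgroups).
* [LyndonSchupp1977] R. Lyndon, P. Schupp, *Combinatorial Group Theory*, Springer 1977, IV.2
  (normal form / reduced words in amalgamated products).
-/

namespace Literature.GroupTheory.ArithmeticGroups

namespace IharaAmalgam

/-! ### The abstract ping-pong lemma for two subgroups -/

section PingPong

variable {Γ : Type*} [Group Γ] {Ω : Type*} [MulAction Γ Ω]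
  (K : Bool → Subgroup Γ) (X : Bool → Set Ω)

/-- Two distinct booleans are negations of each other. [folklore] -/
private lemma eq_not_of_ne {a b : Bool} (h : a ≠ b) : b = !a := by
  cases a <;> cases b <;> simp_all

/-- **Ping-pong, transport step.** If every letter of `K i ∖ K (!i)` maps `X (!i)` into `X i`, then a
reduced alternating word with first letter in `K i` and last letter in `K j` maps `X (!j)` into `X i`.
[cite: Serre1980Trees, I.4.1 proof of Thm. 6; LyndonSchupp1977, IV.2] -/
theorem pingPong_smul_mem
    (h : ∀ i, ∀ g ∈ K i, g ∉ K (!i) → ∀ z ∈ X (!i), g • z ∈ X i)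
    (l : List (Bool × Γ)) (hK : ∀ x ∈ l, x.2 ∈ K x.1 ∧ x.2 ∉ K (!x.1))
    (hc : l.IsChain (fun x y => x.1 ≠ y.1)) {a b : Bool × Γ} (ha : l.head? = some a)
    (hb : l.getLast? = some b) {z : Ω} (hz : z ∈ X (!b.1)) :
    (l.map Prod.snd).prod • z ∈ X a.1 := by
  induction l generalizing a with
  | nil => simp at ha
  | cons x l ih =>
    have hax : a = x := by simpa using ha.symm
    subst hax
    by_cases hl : l = []
    · subst hl
      have hb' : b = a := by simpa using hb.symm
      rw [hb'] at hz
      simpa using h a.1 a.2 (hK a (by simp)).1 (hK a (by simp)).2 z hz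
    · obtain ⟨a', ha'⟩ : ∃ a', l.head? = some a' := by
        cases l with
        | nil => exact absurd rfl hl
        | cons y l => exact ⟨y, rfl⟩
      have hb'' : l.getLast? = some b := by
        rw [List.getLast?_cons] at hb
        cases hl' : l.getLast? with
        | none => exact absurd (List.getLast?_eq_none_iff.mp hl') hl
        | some c => rw [hl'] at hb; simpa using hb
      have hne : a.1 ≠ a'.1 := by
        cases l with
        | nil => exact absurd rfl hl
        | cons y l =>
          have hy : a' = y := by simpa using ha'.symm
          subst hy
          exact (List.isChain_cons_cons.mp hc).1
      have ha'1 : a'.1 = !a.1 := eq_not_of_ne hne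
      have ih' := ih (fun x hx => hK x (List.mem_cons_of_mem _ hx)) (List.IsChain.tail hc) ha' hb''
      rw [ha'1] at ih'
      rw [List.map_cons, List.prod_cons, mul_smul]
      exact h a.1 a.2 (hK a (by simp)).1 (hK a (by simp)).2 _ ih'

/-- **Ping-pong, same-type words.** A reduced alternating word whose first and last letters lie in
the same factor is `≠ 1`. [cite: Serre1980Trees, I.4.1 Thm. 6; LyndonSchupp1977, IV.2] -/
theorem pingPong_prod_ne_one_of_fst_eq
    (h : ∀ i, ∀ g ∈ K i, g ∉ K (!i) → ∀ z ∈ X (!i), g • z ∈ X i)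
    (hdisj : Disjoint (X false) (X true)) (hne : ∀ i, (X i).Nonempty)
    (l : List (Bool × Γ)) (hK : ∀ x ∈ l, x.2 ∈ K x.1 ∧ x.2 ∉ K (!x.1))
    (hc : l.IsChain (fun x y => x.1 ≠ y.1)) {a b : Bool × Γ} (ha : l.head? = some a)
    (hb : l.getLast? = some b) (hab : a.1 = b.1) :
    (l.map Prod.snd).prod ≠ 1 := by
  obtain ⟨z, hz⟩ := hne (!b.1)
  have hmem := pingPong_smul_mem K X h l hK hc ha hb hz
  intro heq
  rw [heq, one_smul, hab] at hmem
  have hd : Disjoint (X b.1) (X (!b.1)) := by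
    cases b.1
    · exact hdisj
    · exact hdisj.symm
  exact Set.disjoint_left.mp hd hmem hz

/-- **The ping-pong lemma for an amalgam of two subgroups.** Let `K false, K true ≤ Γ` act on `Ω`
with disjoint non-empty `X false, X true` such that `K i ∖ K (!i)` maps `X (!i)` into `X i`, and
suppose each `K i` has at least three cosets of `K false ⊓ K true` in the form: for every
`u ∈ K i` some `c ∈ K i` has `c, c u ∉ K (!i)`. Then every non-empty reduced alternating word in
the `K i` has product `≠ 1` in `Γ`. [cite: Serre1980Trees, I.4.1 Thm. 6; LyndonSchupp1977, IV.2] -/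
theorem pingPong_prod_ne_one
    (h : ∀ i, ∀ g ∈ K i, g ∉ K (!i) → ∀ z ∈ X (!i), g • z ∈ X i)
    (hdisj : Disjoint (X false) (X true)) (hne : ∀ i, (X i).Nonempty)
    (hcx : ∀ i, ∀ u ∈ K i, ∃ c ∈ K i, c ∉ K (!i) ∧ c * u ∉ K (!i))
    (l : List (Bool × Γ)) (hl : l ≠ []) (hK : ∀ x ∈ l, x.2 ∈ K x.1 ∧ x.2 ∉ K (!x.1))
    (hc : l.IsChain (fun x y => x.1 ≠ y.1)) :
    (l.map Prod.snd).prod ≠ 1 := by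
  obtain ⟨a, t, rfl⟩ : ∃ a t, l = a :: t := by
    cases l with
    | nil => exact absurd rfl hl
    | cons a t => exact ⟨a, t, rfl⟩
  obtain ⟨b, hb⟩ : ∃ b, (a :: t).getLast? = some b :=
    Option.ne_none_iff_exists'.mp (by simp)
  by_cases hab : a.1 = b.1
  · exact pingPong_prod_ne_one_of_fst_eq K X h hdisj hne (a :: t) hK hc rfl hb hab
  · -- `t ≠ []`, else `a = b`
    have ht : t ≠ [] := by
      rintro rfl
      have hab' : a = b := by simpa using hb
      exact hab (by rw [hab'])
    obtain ⟨c, hcK, hc1, hc2⟩ := hcx a.1 a.2 (hK a (by simp)).1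
    -- the conjugated word `(c a) t c⁻¹`, of the same type at both ends
    let l₂ : List (Bool × Γ) := (a.1, c * a.2) :: (t ++ [(a.1, c⁻¹)])
    have hK₂ : ∀ x ∈ l₂, x.2 ∈ K x.1 ∧ x.2 ∉ K (!x.1) := by
      intro x hx
      simp only [l₂, List.mem_cons, List.mem_append] at hx
      rcases hx with rfl | hx | rfl | hx
      · exact ⟨(K a.1).mul_mem hcK (hK a (by simp)).1, hc2⟩
      · exact hK x (List.mem_cons_of_mem _ hx)
      · exact ⟨(K a.1).inv_mem hcK, fun h' => hc1 (by simpa using (K (!a.1)).inv_mem h')⟩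
      · simp at hx
    have hc₂ : l₂.IsChain (fun x y => x.1 ≠ y.1) := by
      simp only [l₂]
      rw [List.isChain_cons, List.isChain_append]
      refine ⟨?_, List.IsChain.tail hc, List.isChain_singleton _, ?_⟩
      · -- the head of `t ++ [_]` is the head of `t`
        intro y hy
        obtain ⟨y₀, t', rfl⟩ : ∃ y₀ t', t = y₀ :: t' := by
          cases t with
          | nil => exact absurd rfl ht
          | cons y₀ t' => exact ⟨y₀, t', rfl⟩
        have hy' : y = y₀ := by simpa using hy.symm
        subst hy'
        exact (List.isChain_cons_cons.mp hc).1
      · intro x hx y hy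
        have hy' : y = (a.1, c⁻¹) := by simpa using hy.symm
        subst hy'
        -- `x` is the last letter of `t`, i.e. `b`
        have hxb : x = b := by
          rw [List.getLast?_cons] at hb
          have : t.getLast? = some x := by simpa using hx
          rw [this] at hb
          simpa using hb
        subst hxb
        exact fun h' => hab h'.symm
    have hne₂ := pingPong_prod_ne_one_of_fst_eq K X h hdisj hne l₂ hK₂ hc₂ rfl
      (b := (a.1, c⁻¹)) (by simp [l₂, List.getLast?_cons, List.getLast?_append]) rfl
    intro heq
    apply hne₂
    have ht' : (t.map Prod.snd).prod = a.2⁻¹ := by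
      rw [List.map_cons, List.prod_cons] at heq
      exact eq_inv_of_mul_eq_one_right heq
    simp only [l₂, List.map_cons, List.map_append, List.prod_cons, List.prod_append, ht',
      List.map_nil, List.prod_nil, mul_one]
    group

end PingPong

/-! ### `p`-adic valuation bookkeeping on `ℚ` -/

section Valuation

variable {p : ℕ}

/-- Integers have non-negative valuation. [folklore] -/
private theorem padicValRat_intCast_nonneg (z : ℤ) : 0 ≤ padicValRat p (z : ℚ) := by
  rw [padicValRat.of_int]; positivity

/-- An integer prime to `p` is a `p`-adic unit. [folklore] -/
private theorem padicValRat_intCast_eq_zero {z : ℤ} (hz : ¬ (p : ℤ) ∣ z) : padicValRat p (z : ℚ) = 0 := by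
  rw [padicValRat.of_int, padicValInt.eq_zero_of_not_dvd hz]; simp

/-- An integer prime to `p` is non-zero (in `ℚ`). [folklore] -/
private theorem intCast_ne_zero_of_not_dvd {z : ℤ} (hz : ¬ (p : ℤ) ∣ z) : (z : ℚ) ≠ 0 := by
  rintro h
  exact hz (by rw [show z = 0 by exact_mod_cast h]; exact dvd_zero _)

variable [Fact p.Prime]

/-- Ultrametric lower bound with zero summands allowed. [folklore] -/
private theorem le_padicValRat_add {n : ℤ} {x y : ℚ} (hx : x = 0 ∨ n ≤ padicValRat p x)
    (hy : y = 0 ∨ n ≤ padicValRat p y) (hxy : x + y ≠ 0) : n ≤ padicValRat p (x + y) := by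
  rcases hx with rfl | hx
  · rw [zero_add] at hxy ⊢
    rcases hy with rfl | hy
    · exact absurd rfl hxy
    · exact hy
  rcases hy with rfl | hy
  · rwa [add_zero]
  exact le_trans (le_min hx hy) (padicValRat.min_le_padicValRat_add hxy)

/-- Strict ultrametric domination: a summand of smaller valuation decides. [folklore] -/
private theorem padicValRat_add_eq_of_lt {n : ℤ} {x y : ℚ} (hx0 : x ≠ 0) (hx : padicValRat p x < n)
    (hy : y = 0 ∨ n ≤ padicValRat p y) : x + y ≠ 0 ∧ padicValRat p (x + y) = padicValRat p x := by
  by_cases hy0 : y = 0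
  · subst hy0; rw [add_zero]; exact ⟨hx0, rfl⟩
  rcases hy with rfl | hy
  · exact absurd rfl hy0
  have hne : padicValRat p x ≠ padicValRat p y := ne_of_lt (lt_of_lt_of_le hx hy)
  have hxy : x + y ≠ 0 := by
    intro h
    have : x = -y := eq_neg_of_add_eq_zero_left h
    rw [this, padicValRat.neg] at hne
    exact hne rfl
  exact ⟨hxy, by rw [padicValRat.add_eq_min hxy hx0 hy0 hne, min_eq_left (le_of_lt (lt_of_lt_of_le hx hy))]⟩

end Valuation

/-! ### Möbius action of `SL₂(ℤ)` and of `A = diag(p, 1)` on `ℙ¹(ℚ) = OnePoint ℚ` -/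

section Moebius

open scoped MatrixGroups
open Matrix.SpecialLinearGroup OnePoint

variable {p : ℕ} [Fact p.Prime]

/-- Entries of `mapGL ℚ γ` (the embedding `SL₂(ℤ) ↪ GL₂(ℚ)`). [cite: Serre1980Trees, II.1.4 (notation)] -/
theorem mapGL_rat_apply (γ : SL(2, ℤ)) (i j : Fin 2) :
    ((mapGL ℚ γ : GL (Fin 2) ℚ) : Matrix (Fin 2) (Fin 2) ℚ) i j = (γ i j : ℚ) := by
  simp [Matrix.SpecialLinearGroup.mapGL]

omit [Fact p.Prime] in
/-- `A = diag(p, 1)` acts on finite points by `t ↦ p t`. [folklore] -/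
private theorem diag_smul_coe {A : GL (Fin 2) ℚ} (hA : (A : Matrix (Fin 2) (Fin 2) ℚ) = !![(p : ℚ), 0; 0, 1])
    (t : ℚ) : A • ((t : ℚ) : OnePoint ℚ) = ((p * t : ℚ) : OnePoint ℚ) := by
  rw [smul_some_eq_ite]; simp [hA]

omit [Fact p.Prime] in
/-- `A = diag(p, 1)` fixes `∞`. [folklore] -/
private theorem diag_smul_infty {A : GL (Fin 2) ℚ} (hA : (A : Matrix (Fin 2) (Fin 2) ℚ) = !![(p : ℚ), 0; 0, 1]) :
    A • (∞ : OnePoint ℚ) = ∞ := by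
  rw [smul_infty_eq_ite]; simp [hA]

/-- `A⁻¹` acts on finite points by `t ↦ t / p`. [folklore] -/
private theorem diag_inv_smul_coe {A : GL (Fin 2) ℚ} (hA : (A : Matrix (Fin 2) (Fin 2) ℚ) = !![(p : ℚ), 0; 0, 1])
    (t : ℚ) : A⁻¹ • ((t : ℚ) : OnePoint ℚ) = ((t / p : ℚ) : OnePoint ℚ) := by
  rw [inv_smul_eq_iff, diag_smul_coe hA]
  have hp : (p : ℚ) ≠ 0 := by exact_mod_cast (Fact.out : p.Prime).ne_zero
  rw [mul_div_cancel₀ _ hp]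

omit [Fact p.Prime] in
/-- `A⁻¹` fixes `∞`. [folklore] -/
private theorem diag_inv_smul_infty {A : GL (Fin 2) ℚ}
    (hA : (A : Matrix (Fin 2) (Fin 2) ℚ) = !![(p : ℚ), 0; 0, 1]) : A⁻¹ • (∞ : OnePoint ℚ) = ∞ := by
  rw [inv_smul_eq_iff, diag_smul_infty hA]

/-- **Ping.** An element of `SL₂(ℤ)` whose lower-left entry is prime to `p` (i.e. outside `Γ₀(p)`)
maps the complement of the `p`-integral points `{t : v_p(t) ≥ 0}` of `ℙ¹(ℚ)` into the `p`-integral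
points. [cite: Serre1980Trees, II.1.4 (the tree of `SL₂(ℚ_p)`)] -/
theorem mapGL_smul_mem_of_not_dvd (X : Set (OnePoint ℚ))
    (hX : ∀ z, z ∈ X ↔ ∃ t : ℚ, z = t ∧ 0 ≤ padicValRat p t)
    {γ : SL(2, ℤ)} (hγ : ¬ (p : ℤ) ∣ γ 1 0) {z : OnePoint ℚ} (hz : z ∉ X) :
    mapGL ℚ γ • z ∈ X := by
  have hc0 : ((γ 1 0 : ℤ) : ℚ) ≠ 0 := intCast_ne_zero_of_not_dvd hγ
  have hcv : padicValRat p ((γ 1 0 : ℤ) : ℚ) = 0 := padicValRat_intCast_eq_zero hγ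
  induction z using OnePoint.rec with
  | infty =>
    rw [smul_infty_eq_ite, mapGL_rat_apply, mapGL_rat_apply, if_neg hc0, hX]
    refine ⟨_, rfl, ?_⟩
    by_cases ha : ((γ 0 0 : ℤ) : ℚ) = 0
    · rw [ha, zero_div, padicValRat.zero]
    · rw [padicValRat.div ha hc0, hcv, sub_zero]
      exact padicValRat_intCast_nonneg _
  | coe t =>
    -- `v_p(t) < 0`
    have ht : padicValRat p t < 0 := by
      by_contra h
      exact hz ((hX _).mpr ⟨t, rfl, not_lt.mp h⟩)
    have ht0 : t ≠ 0 := by rintro rfl; rw [padicValRat.zero] at ht; exact lt_irrefl _ ht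
    rw [smul_some_eq_ite]
    simp only [mapGL_rat_apply]
    -- the denominator `c t + d` has valuation `v(t) < 0`, in particular it is non-zero
    have hct : padicValRat p ((γ 1 0 : ℚ) * t) = padicValRat p t := by
      rw [padicValRat.mul hc0 ht0, hcv, zero_add]
    obtain ⟨hden0, hden⟩ := padicValRat_add_eq_of_lt (n := 0) (mul_ne_zero hc0 ht0)
      (hct.symm ▸ ht) (Or.inr (padicValRat_intCast_nonneg (γ 1 1)))
    rw [if_neg hden0, hX]
    refine ⟨_, rfl, ?_⟩
    by_cases hnum : (γ 0 0 : ℚ) * t + γ 0 1 = 0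
    · rw [hnum, zero_div, padicValRat.zero]
    · rw [padicValRat.div hnum hden0, hden, hct, sub_nonneg]
      refine le_padicValRat_add ?_ (Or.inr ?_) hnum
      · by_cases ha : ((γ 0 0 : ℤ) : ℚ) = 0
        · exact Or.inl (by rw [ha, zero_mul])
        · exact Or.inr (by rw [padicValRat.mul ha ht0]; linarith [padicValRat_intCast_nonneg (p := p) (γ 0 0)])
      · linarith [padicValRat_intCast_nonneg (p := p) (γ 0 1)]

/-- **Pong.** For `γ ∈ SL₂(ℤ)` whose upper-right entry is prime to `p`, the conjugate `A⁻¹ γ A`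
(`A = diag(p, 1)`; this is `[a, b/p; p c, d]`, outside `SL₂(ℤ)`) maps the `p`-integral points of
`ℙ¹(ℚ)` into their complement. [cite: Serre1980Trees, II.1.4 (the tree of `SL₂(ℚ_p)`)] -/
theorem conj_mapGL_smul_not_mem_of_not_dvd (X : Set (OnePoint ℚ))
    (hX : ∀ z, z ∈ X ↔ ∃ t : ℚ, z = t ∧ 0 ≤ padicValRat p t)
    {A : GL (Fin 2) ℚ} (hA : (A : Matrix (Fin 2) (Fin 2) ℚ) = !![(p : ℚ), 0; 0, 1])
    {γ : SL(2, ℤ)} (hγ : ¬ (p : ℤ) ∣ γ 0 1) {z : OnePoint ℚ} (hz : z ∈ X) :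
    (A⁻¹ * mapGL ℚ γ * A) • z ∉ X := by
  have hp : (p : ℚ) ≠ 0 := by exact_mod_cast (Fact.out : p.Prime).ne_zero
  have hpv : padicValRat p (p : ℚ) = 1 := padicValRat.self (Fact.out : p.Prime).one_lt
  have hb0 : ((γ 0 1 : ℤ) : ℚ) ≠ 0 := intCast_ne_zero_of_not_dvd hγ
  have hbv : padicValRat p ((γ 0 1 : ℤ) : ℚ) = 0 := padicValRat_intCast_eq_zero hγ
  obtain ⟨t, rfl, ht⟩ := (hX z).mp hz
  rw [mul_smul, mul_smul, diag_smul_coe hA, smul_some_eq_ite]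
  simp only [mapGL_rat_apply]
  -- numerator `a p t + b`: valuation `0`, non-zero
  have hnum : (γ 0 0 : ℚ) * (p * t) + γ 0 1 ≠ 0 ∧
      padicValRat p ((γ 0 0 : ℚ) * (p * t) + γ 0 1) = 0 := by
    rw [add_comm]
    have h := padicValRat_add_eq_of_lt (p := p) (n := 1) hb0 (by rw [hbv]; exact zero_lt_one)
      (y := (γ 0 0 : ℚ) * (p * t)) ?_
    · exact ⟨h.1, h.2.trans hbv⟩
    · by_cases ha : ((γ 0 0 : ℤ) : ℚ) = 0
      · exact Or.inl (by rw [ha, zero_mul])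
      by_cases ht0 : t = 0
      · exact Or.inl (by rw [ht0, mul_zero, mul_zero])
      refine Or.inr ?_
      rw [padicValRat.mul ha (mul_ne_zero hp ht0), padicValRat.mul hp ht0, hpv]
      linarith [padicValRat_intCast_nonneg (p := p) (γ 0 0)]
  split_ifs with hden
  · rw [diag_inv_smul_infty hA, hX]
    rintro ⟨s, hs, -⟩
    exact OnePoint.infty_ne_coe _ hs
  · rw [diag_inv_smul_coe hA, hX]
    rintro ⟨s, hs, hsv⟩
    rw [OnePoint.coe_eq_coe] at hs
    rw [← hs, padicValRat.div (div_ne_zero hnum.1 hden) hp, hpv,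
      padicValRat.div hnum.1 hden, hnum.2] at hsv
    -- `0 ≤ 0 - v(den) - 1` contradicts `v(den) ≥ 0`
    have hdv : 0 ≤ padicValRat p ((γ 1 0 : ℚ) * (p * t) + γ 1 1) := by
      refine le_padicValRat_add ?_ (Or.inr (padicValRat_intCast_nonneg _)) hden
      by_cases hc : ((γ 1 0 : ℤ) : ℚ) = 0
      · exact Or.inl (by rw [hc, zero_mul])
      by_cases ht0 : t = 0
      · exact Or.inl (by rw [ht0, mul_zero, mul_zero])
      refine Or.inr ?_
      rw [padicValRat.mul hc (mul_ne_zero hp ht0), padicValRat.mul hp ht0, hpv]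
      linarith [padicValRat_intCast_nonneg (p := p) (γ 1 0)]
    linarith

end Moebius

/-! ### Matrix bookkeeping: `A Γ₀(p) A⁻¹ ⊆ SL₂(ℤ)`, strong approximation `Γ(N) ↠ SL₂(𝔽_p)` -/

section Matrices

open scoped MatrixGroups
open Matrix.SpecialLinearGroup CongruenceSubgroup

variable {N p : ℕ}

/-- Membership in `Γ(M)` as four divisibilities. [cite: Serre1980Trees, II.1.4 (congruence subgroups `Γ(N)`)] -/
theorem mem_Gamma_iff_dvd {M : ℕ} {γ : SL(2, ℤ)} :
    γ ∈ Gamma M ↔ (M : ℤ) ∣ γ 0 0 - 1 ∧ (M : ℤ) ∣ γ 0 1 ∧ (M : ℤ) ∣ γ 1 0 ∧ (M : ℤ) ∣ γ 1 1 - 1 := by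
  rw [Gamma_mem]
  have h1 : ∀ x : ℤ, (x : ZMod M) = 1 ↔ (M : ℤ) ∣ x - 1 := fun x ↦ by
    rw [← ZMod.intCast_zmod_eq_zero_iff_dvd, Int.cast_sub, Int.cast_one, sub_eq_zero]
  simp only [h1, ZMod.intCast_zmod_eq_zero_iff_dvd]

/-- The `GL₂(ℚ)` bookkeeping for `A = diag(p, 1)`: `A x = y A` as soon as `y = A x A⁻¹` entrywise,
i.e. `y₀₀ = x₀₀`, `y₀₁ = p x₀₁`, `p y₁₀ = x₁₀`, `y₁₁ = x₁₁`. [cite: Serre1980Trees, II.1.4 (the matrix `A`)] -/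
theorem diag_mul_mapGL_eq_mapGL_mul_diag {A : GL (Fin 2) ℚ}
    (hA : (A : Matrix (Fin 2) (Fin 2) ℚ) = !![(p : ℚ), 0; 0, 1]) {x y : SL(2, ℤ)}
    (h00 : y 0 0 = x 0 0) (h01 : y 0 1 = p * x 0 1) (h10 : (p : ℤ) * y 1 0 = x 1 0)
    (h11 : y 1 1 = x 1 1) :
    A * mapGL ℚ x = mapGL ℚ y * A := by
  have r00 : ((y 0 0 : ℤ) : ℚ) = x 0 0 := by exact_mod_cast h00
  have r01 : ((y 0 1 : ℤ) : ℚ) = p * x 0 1 := by exact_mod_cast h01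
  have r10 : (p : ℚ) * y 1 0 = x 1 0 := by exact_mod_cast h10
  apply Units.ext
  rw [Units.val_mul, Units.val_mul, hA]
  ext i j
  fin_cases i <;> fin_cases j <;>
    simp [Matrix.mul_apply, Fin.sum_univ_two]
  · linear_combination (p : ℚ) * r00.symm
  · linear_combination -r01
  · linear_combination -r10
  · exact h11.symm

/-- `A (Γ(N) ∩ Γ₀(p)) A⁻¹ ⊆ Γ(N)` for `p ∤ N`: for `x ∈ Γ(N)` with `p ∣ x₁₀` the matrix
`A x A⁻¹ = [x₀₀, p x₀₁; x₁₀/p, x₁₁]` lies in `Γ(N)`. [cite: Serre1980Trees, II.1.4] -/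
theorem exists_mem_Gamma_diag_mul_eq (hNp : N.Coprime p) {A : GL (Fin 2) ℚ}
    (hA : (A : Matrix (Fin 2) (Fin 2) ℚ) = !![(p : ℚ), 0; 0, 1]) {x : SL(2, ℤ)} (hx : x ∈ Gamma N)
    (hpx : (p : ℤ) ∣ x 1 0) : ∃ y ∈ Gamma N, A * mapGL ℚ x = mapGL ℚ y * A := by
  obtain ⟨c, hc⟩ := hpx
  have hdet : x 0 0 * x 1 1 - x 0 1 * x 1 0 = 1 := by
    have := Matrix.det_fin_two (x : Matrix (Fin 2) (Fin 2) ℤ)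
    rw [x.det_coe] at this
    exact this.symm
  let y : SL(2, ℤ) := ⟨!![x 0 0, p * x 0 1; c, x 1 1], by
    rw [Matrix.det_fin_two_of]; linear_combination hdet + x 0 1 * hc⟩
  refine ⟨y, ?_, diag_mul_mapGL_eq_mapGL_mul_diag hA rfl rfl hc.symm rfl⟩
  obtain ⟨h00, h01, h10, h11⟩ := mem_Gamma_iff_dvd.mp hx
  rw [mem_Gamma_iff_dvd]
  refine ⟨h00, (Dvd.dvd.mul_left h01 _), ?_, h11⟩
  -- `N ∣ x₁₀ = p c` and `gcd(N, p) = 1` give `N ∣ c`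
  rw [hc] at h10
  exact (Nat.isCoprime_iff_coprime.mpr hNp).dvd_of_dvd_mul_left h10

/-- `A⁻¹ (Γ(N) ∩ Γ⁰(p)) A ⊆ Γ(N)` for `p ∤ N`: for `y ∈ Γ(N)` with `p ∣ y₀₁` the matrix
`A⁻¹ y A = [y₀₀, y₀₁/p; p y₁₀, y₁₁]` lies in `Γ(N)`. [cite: Serre1980Trees, II.1.4] -/
theorem exists_mem_Gamma_mapGL_mul_diag_eq (hNp : N.Coprime p) {A : GL (Fin 2) ℚ}
    (hA : (A : Matrix (Fin 2) (Fin 2) ℚ) = !![(p : ℚ), 0; 0, 1]) {y : SL(2, ℤ)} (hy : y ∈ Gamma N)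
    (hpy : (p : ℤ) ∣ y 0 1) : ∃ x ∈ Gamma N, A * mapGL ℚ x = mapGL ℚ y * A := by
  obtain ⟨b, hb⟩ := hpy
  have hdet : y 0 0 * y 1 1 - y 0 1 * y 1 0 = 1 := by
    have := Matrix.det_fin_two (y : Matrix (Fin 2) (Fin 2) ℤ)
    rw [y.det_coe] at this
    exact this.symm
  let x : SL(2, ℤ) := ⟨!![y 0 0, b; p * y 1 0, y 1 1], by
    rw [Matrix.det_fin_two_of]; linear_combination hdet + y 1 0 * hb⟩
  refine ⟨x, ?_, diag_mul_mapGL_eq_mapGL_mul_diag hA rfl hb rfl rfl⟩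
  obtain ⟨h00, h01, h10, h11⟩ := mem_Gamma_iff_dvd.mp hy
  rw [mem_Gamma_iff_dvd]
  refine ⟨h00, ?_, Dvd.dvd.mul_left h10 _, h11⟩
  -- `N ∣ y₀₁ = p b` and `gcd(N, p) = 1` give `N ∣ b`
  rw [hb] at h01
  exact (Nat.isCoprime_iff_coprime.mpr hNp).dvd_of_dvd_mul_left h01

/-- Entry comparison in `A x = y A`: then `x₁₀ = p y₁₀` and `y₀₁ = p x₀₁`; in particular
`p ∣ x₁₀` and `p ∣ y₀₁`. [cite: Serre1980Trees, II.1.4 (the matrix `A`)] -/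
theorem dvd_of_diag_mul_mapGL_eq {A : GL (Fin 2) ℚ}
    (hA : (A : Matrix (Fin 2) (Fin 2) ℚ) = !![(p : ℚ), 0; 0, 1]) {x y : SL(2, ℤ)}
    (h : A * mapGL ℚ x = mapGL ℚ y * A) : (p : ℤ) ∣ x 1 0 ∧ (p : ℤ) ∣ y 0 1 := by
  have hv := congrArg (fun g : GL (Fin 2) ℚ ↦ (g : Matrix (Fin 2) (Fin 2) ℚ)) h
  simp only [Units.val_mul, hA] at hv
  have h10 := congrFun (congrFun hv 1) 0
  have h01 := congrFun (congrFun hv 0) 1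
  simp [Matrix.mul_apply, Fin.sum_univ_two] at h10 h01
  refine ⟨⟨y 1 0, ?_⟩, ⟨x 0 1, ?_⟩⟩
  · have : ((x 1 0 : ℤ) : ℚ) = ((p * y 1 0 : ℤ) : ℚ) := by push_cast; linear_combination h10
    exact_mod_cast this
  · have : ((y 0 1 : ℤ) : ℚ) = ((p * x 0 1 : ℤ) : ℚ) := by push_cast; linear_combination -h01
    exact_mod_cast this

/-- Integer Chinese remainder for the coprime moduli `N`, `p`. [folklore] -/
private lemma exists_dvd_sub_and_dvd_sub (hc : IsCoprime (N : ℤ) (p : ℤ)) (a b : ℤ) :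
    ∃ k : ℤ, (N : ℤ) ∣ k - a ∧ (p : ℤ) ∣ k - b := by
  obtain ⟨u, v, huv⟩ := hc
  refine ⟨a * (v * p) + b * (u * N), ⟨u * (b - a), ?_⟩, ⟨v * (a - b), ?_⟩⟩
  · linear_combination a * huv
  · linear_combination b * huv

/-- **Strong approximation `Γ(N) ↠ SL₂(ℤ/p)`** for `gcd(N, p) = 1`: every `B ∈ SL₂(ℤ)` is congruent
modulo `p` to an element of `Γ(N)` (the reduction `SL₂(ℤ) → SL₂(ℤ/Np)` is onto — tree
`IntegerSpecialLinear.exists_specialLinearGroup_intModEq` — and `ℤ/Np ≅ ℤ/N × ℤ/p`).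
[cite: Serre1980Trees, II.1.4 Cor. 1 (proof: `Γ(N)` is transitive on the edges at a vertex)] -/
theorem exists_mem_Gamma_forall_dvd_sub (hNp : N.Coprime p) (B : SL(2, ℤ)) :
    ∃ γ ∈ Gamma N, ∀ i j, (p : ℤ) ∣ γ i j - B i j := by
  have hc : IsCoprime (N : ℤ) (p : ℤ) := Nat.isCoprime_iff_coprime.mpr hNp
  choose k hk using fun ij : Fin 2 × Fin 2 ↦
    exists_dvd_sub_and_dvd_sub hc ((1 : Matrix (Fin 2) (Fin 2) ℤ) ij.1 ij.2) (B ij.1 ij.2)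
  let M₀ : Matrix (Fin 2) (Fin 2) ℤ := Matrix.of fun i j ↦ k (i, j)
  have hMN : ∀ i j, ((M₀ i j : ℤ) : ZMod N) = (((1 : Matrix (Fin 2) (Fin 2) ℤ) i j : ℤ) : ZMod N) :=
    fun i j ↦ by
    have := (ZMod.intCast_zmod_eq_zero_iff_dvd _ N).mpr (hk (i, j)).1
    rwa [Int.cast_sub, sub_eq_zero] at this
  have hMp : ∀ i j, ((M₀ i j : ℤ) : ZMod p) = ((B i j : ℤ) : ZMod p) := fun i j ↦ by
    have := (ZMod.intCast_zmod_eq_zero_iff_dvd _ p).mpr (hk (i, j)).2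
    rwa [Int.cast_sub, sub_eq_zero] at this
  -- `det M₀ ≡ 1` modulo `N` and modulo `p`, hence modulo `N p`
  have hdet_mod : ∀ (m : ℕ) (C : Matrix (Fin 2) (Fin 2) ℤ), C.det = 1 →
      (∀ i j, ((M₀ i j : ℤ) : ZMod m) = ((C i j : ℤ) : ZMod m)) → (m : ℤ) ∣ 1 - M₀.det := by
    intro m C hC hMC
    have hmap : M₀.map (Int.castRingHom (ZMod m)) = C.map (Int.castRingHom (ZMod m)) := by
      ext i j
      simpa only [Matrix.map_apply, eq_intCast] using hMC i j
    have h := congr_arg Matrix.det hmap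
    rw [← RingHom.mapMatrix_apply, ← RingHom.mapMatrix_apply, ← RingHom.map_det,
      ← RingHom.map_det, hC, map_one, eq_intCast] at h
    rw [← ZMod.intCast_zmod_eq_zero_iff_dvd, Int.cast_sub, Int.cast_one, h, sub_self]
  have hdetN := hdet_mod N 1 Matrix.det_one hMN
  have hdetp := hdet_mod p (B : Matrix (Fin 2) (Fin 2) ℤ) B.det_coe hMp
  have hdet : M₀.det ≡ 1 [ZMOD ((N * p : ℕ) : ℤ)] := by
    rw [Int.modEq_iff_dvd, Nat.cast_mul]
    exact hc.mul_dvd hdetN hdetp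
  obtain ⟨V, hV⟩ :=
    Literature.LinearAlgebra.Matrix.IntegerSpecialLinear.exists_specialLinearGroup_intModEq
      (N * p) M₀ hdet
  refine ⟨V, ?_, fun i j ↦ ?_⟩
  · rw [Gamma_mem]
    have hVN : ∀ i j, ((V i j : ℤ) : ZMod N) = (((1 : Matrix (Fin 2) (Fin 2) ℤ) i j : ℤ) : ZMod N) :=
      fun i j ↦ by
      rw [← hMN i j]
      exact ((ZMod.intCast_eq_intCast_iff _ _ _).mpr
        ((hV i j).of_mul_right p : M₀ i j ≡ V i j [ZMOD N])).symm
    refine ⟨?_, ?_, ?_, ?_⟩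
    · simpa using hVN 0 0
    · simpa using hVN 0 1
    · simpa using hVN 1 0
    · simpa using hVN 1 1
  · have h := hV i j
    rw [Nat.cast_mul, mul_comm] at h
    have h' : V i j ≡ M₀ i j [ZMOD p] := (h.of_mul_right N).symm
    -- `p ∣ V - M₀` and `p ∣ M₀ - B`
    have : (p : ℤ) ∣ (V i j - M₀ i j) + (M₀ i j - B i j) := dvd_add h'.symm.dvd (hk (i, j)).2
    simpa using this

end Matrices

/-! ### The two vertex groups `K₀ = Γ(N)`, `K₁ = A⁻¹ Γ(N) A` in `GL₂(ℚ)` and the edge group `K₀ ⊓ K₁` -/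

section Amalgam

open scoped MatrixGroups
open Matrix.SpecialLinearGroup CongruenceSubgroup OnePoint

variable {N p : ℕ} {A : GL (Fin 2) ℚ} {K₀ K₁ : Subgroup (GL (Fin 2) ℚ)}

/-- A residue computation: `p ∣ x - 1` excludes `p ∣ x` (`p` prime). [folklore] -/
private lemma not_dvd_of_dvd_sub_one (hp : p.Prime) {x : ℤ} (h : (p : ℤ) ∣ x - 1) : ¬ (p : ℤ) ∣ x := by
  intro hx
  have : (p : ℤ) ∣ 1 := by simpa using dvd_sub hx h
  exact hp.ne_one (by exact_mod_cast Int.eq_one_of_dvd_one (by positivity) this)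

/-- `mapGL γ ∈ K₁ = A⁻¹ Γ(N) A` iff `p ∣ γ₁₀` (`γ ∈ Γ(N)`, `p ∤ N`): the edge group `K₀ ⊓ K₁` is the image
of `Γ(N) ∩ Γ₀(p)`. [cite: Serre1980Trees, II.1.4 Cor. 1] -/
theorem mapGL_mem_iff_dvd (hNp : N.Coprime p) (hA : (A : Matrix (Fin 2) (Fin 2) ℚ) = !![(p : ℚ), 0; 0, 1])
    (hK₀ : ∀ g, g ∈ K₀ ↔ ∃ γ ∈ Gamma N, mapGL ℚ γ = g) (hK₁ : ∀ g, g ∈ K₁ ↔ A * g * A⁻¹ ∈ K₀)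
    {γ : SL(2, ℤ)} (hγ : γ ∈ Gamma N) : mapGL ℚ γ ∈ K₁ ↔ (p : ℤ) ∣ γ 1 0 := by
  rw [hK₁, hK₀]
  constructor
  · rintro ⟨y, -, hy⟩
    rw [eq_comm, mul_inv_eq_iff_eq_mul] at hy
    exact (dvd_of_diag_mul_mapGL_eq hA hy).1
  · intro h
    obtain ⟨y, hy, hAy⟩ := exists_mem_Gamma_diag_mul_eq hNp hA hγ h
    exact ⟨y, hy, by rw [eq_comm, mul_inv_eq_iff_eq_mul, hAy]⟩

/-- `A⁻¹ (mapGL γ) A ∈ K₀ = Γ(N)` iff `p ∣ γ₀₁` (`γ ∈ Γ(N)`, `p ∤ N`). [cite: Serre1980Trees, II.1.4 Cor. 1] -/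
theorem conj_mapGL_mem_iff_dvd (hNp : N.Coprime p)
    (hA : (A : Matrix (Fin 2) (Fin 2) ℚ) = !![(p : ℚ), 0; 0, 1])
    (hK₀ : ∀ g, g ∈ K₀ ↔ ∃ γ ∈ Gamma N, mapGL ℚ γ = g)
    {γ : SL(2, ℤ)} (hγ : γ ∈ Gamma N) : A⁻¹ * mapGL ℚ γ * A ∈ K₀ ↔ (p : ℤ) ∣ γ 0 1 := by
  rw [hK₀]
  constructor
  · rintro ⟨x, -, hx⟩
    rw [mul_assoc, eq_inv_mul_iff_mul_eq] at hx
    exact (dvd_of_diag_mul_mapGL_eq hA hx).2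
  · intro h
    obtain ⟨x, hx, hAx⟩ := exists_mem_Gamma_mapGL_mul_diag_eq hNp hA hγ h
    exact ⟨x, hx, by rw [mul_assoc, eq_inv_mul_iff_mul_eq, hAx]⟩

/-- Elements of `K₁` are the `A⁻¹ (mapGL γ) A`, `γ ∈ Γ(N)`. [cite: Serre1980Trees, II.1.4 (the second vertex group)] -/
theorem mem_iff_exists_conj (hK₀ : ∀ g, g ∈ K₀ ↔ ∃ γ ∈ Gamma N, mapGL ℚ γ = g)
    (hK₁ : ∀ g, g ∈ K₁ ↔ A * g * A⁻¹ ∈ K₀) (g : GL (Fin 2) ℚ) :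
    g ∈ K₁ ↔ ∃ γ ∈ Gamma N, A⁻¹ * mapGL ℚ γ * A = g := by
  rw [hK₁, hK₀]
  refine exists_congr fun γ ↦ and_congr_right fun _ ↦ ⟨fun h ↦ ?_, fun h ↦ ?_⟩
  · rw [h]; group
  · rw [← h]; group

/-- Mod-`p` residue of an entry of a product in `SL₂(ℤ)`. [folklore] -/
private lemma cast_mul_apply (x y : SL(2, ℤ)) (i j : Fin 2) :
    (((x * y) i j : ℤ) : ZMod p) = (x i 0 : ZMod p) * (y 0 j : ZMod p) + (x i 1 : ZMod p) * (y 1 j : ZMod p) := by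
  rw [Matrix.SpecialLinearGroup.coe_mul, Matrix.mul_apply, Fin.sum_univ_two]
  push_cast
  ring

/-- `¬ p ∣ z` iff `z ≠ 0` in `ℤ/p`. [folklore] -/
private lemma not_dvd_iff_cast_ne_zero {z : ℤ} : ¬ (p : ℤ) ∣ z ↔ (z : ZMod p) ≠ 0 := by
  rw [Ne, ZMod.intCast_zmod_eq_zero_iff_dvd]

/-- Transfer of residues: `p ∣ γ - B` entrywise gives equal residues. [folklore] -/
private lemma cast_eq_of_dvd_sub {γ B : SL(2, ℤ)} (h : ∀ i j, (p : ℤ) ∣ γ i j - B i j) (i j : Fin 2) :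
    (γ i j : ZMod p) = (B i j : ZMod p) := by
  have := (ZMod.intCast_zmod_eq_zero_iff_dvd _ p).mpr (h i j)
  rwa [Int.cast_sub, sub_eq_zero] at this

/-- `p` does not divide both entries of a row/column of a determinant-one matrix. [folklore] -/
private lemma not_dvd_of_dvd_det {x : SL(2, ℤ)} (hp : p.Prime) (h : (p : ℤ) ∣ x 0 0) :
    ¬ (p : ℤ) ∣ x 1 0 ∧ ¬ (p : ℤ) ∣ x 0 1 := by
  have hdet : x 0 0 * x 1 1 - x 0 1 * x 1 0 = 1 := by
    have := Matrix.det_fin_two (x : Matrix (Fin 2) (Fin 2) ℤ)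
    rw [x.det_coe] at this
    exact this.symm
  constructor
  · intro h10
    have : (p : ℤ) ∣ 1 := by
      rw [← hdet]; exact dvd_sub (Dvd.dvd.mul_right h _) (Dvd.dvd.mul_left h10 _)
    exact hp.ne_one (by exact_mod_cast Int.eq_one_of_dvd_one (by positivity) this)
  · intro h01
    have : (p : ℤ) ∣ 1 := by
      rw [← hdet]; exact dvd_sub (Dvd.dvd.mul_right h _) (Dvd.dvd.mul_right h01 _)
    exact hp.ne_one (by exact_mod_cast Int.eq_one_of_dvd_one (by positivity) this)

/-- **Three cosets at the vertex `K₀`.** For `u ∈ K₀` some `c ∈ K₀` has `c ∉ K₁` and `c u ∉ K₁`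
(`[K₀ : K₀ ⊓ K₁] = p + 1 ≥ 3`). [cite: Serre1980Trees, II.1.4] -/
theorem exists_mul_not_mem_right (hp : p.Prime) (hNp : N.Coprime p)
    (hA : (A : Matrix (Fin 2) (Fin 2) ℚ) = !![(p : ℚ), 0; 0, 1])
    (hK₀ : ∀ g, g ∈ K₀ ↔ ∃ γ ∈ Gamma N, mapGL ℚ γ = g) (hK₁ : ∀ g, g ∈ K₁ ↔ A * g * A⁻¹ ∈ K₀)
    {u : GL (Fin 2) ℚ} (hu : u ∈ K₀) : ∃ c ∈ K₀, c ∉ K₁ ∧ c * u ∉ K₁ := by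
  obtain ⟨γu, hγu, rfl⟩ := (hK₀ u).mp hu
  -- the residue class of `c` mod `p`: `[0, -1; 1, 0]` if `p ∤ u₀₀`, else `[1, 0; 1, 1]`
  let B₁ : SL(2, ℤ) := ⟨!![0, -1; 1, 0], by norm_num [Matrix.det_fin_two_of]⟩
  let B₂ : SL(2, ℤ) := ⟨!![1, 0; 1, 1], by norm_num [Matrix.det_fin_two_of]⟩
  by_cases h00 : (p : ℤ) ∣ γu 0 0
  · obtain ⟨γc, hγc, hcB⟩ := exists_mem_Gamma_forall_dvd_sub hNp B₂
    have hc10 : ¬ (p : ℤ) ∣ γc 1 0 :=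
      not_dvd_of_dvd_sub_one hp (by simpa [B₂] using hcB 1 0)
    refine ⟨mapGL ℚ γc, (hK₀ _).mpr ⟨γc, hγc, rfl⟩, ?_, ?_⟩
    · rwa [mapGL_mem_iff_dvd hNp hA hK₀ hK₁ hγc]
    · rw [← map_mul, mapGL_mem_iff_dvd hNp hA hK₀ hK₁ (Subgroup.mul_mem _ hγc hγu),
        not_dvd_iff_cast_ne_zero, cast_mul_apply, cast_eq_of_dvd_sub hcB, cast_eq_of_dvd_sub hcB]
      have h10 : (γu 1 0 : ZMod p) ≠ 0 := not_dvd_iff_cast_ne_zero.mp (not_dvd_of_dvd_det hp h00).1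
      have h00' : (γu 0 0 : ZMod p) = 0 := (ZMod.intCast_zmod_eq_zero_iff_dvd _ p).mpr h00
      simpa [B₂, h00'] using h10
  · obtain ⟨γc, hγc, hcB⟩ := exists_mem_Gamma_forall_dvd_sub hNp B₁
    have hc10 : ¬ (p : ℤ) ∣ γc 1 0 :=
      not_dvd_of_dvd_sub_one hp (by simpa [B₁] using hcB 1 0)
    refine ⟨mapGL ℚ γc, (hK₀ _).mpr ⟨γc, hγc, rfl⟩, ?_, ?_⟩
    · rwa [mapGL_mem_iff_dvd hNp hA hK₀ hK₁ hγc]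
    · rw [← map_mul, mapGL_mem_iff_dvd hNp hA hK₀ hK₁ (Subgroup.mul_mem _ hγc hγu),
        not_dvd_iff_cast_ne_zero, cast_mul_apply, cast_eq_of_dvd_sub hcB, cast_eq_of_dvd_sub hcB]
      have h00' : (γu 0 0 : ZMod p) ≠ 0 := not_dvd_iff_cast_ne_zero.mp h00
      simpa [B₁] using h00'

/-- **Three cosets at the vertex `K₁`.** For `u ∈ K₁` some `c ∈ K₁` has `c ∉ K₀` and `c u ∉ K₀`.
[cite: Serre1980Trees, II.1.4] -/
theorem exists_mul_not_mem_left (hp : p.Prime) (hNp : N.Coprime p)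
    (hA : (A : Matrix (Fin 2) (Fin 2) ℚ) = !![(p : ℚ), 0; 0, 1])
    (hK₀ : ∀ g, g ∈ K₀ ↔ ∃ γ ∈ Gamma N, mapGL ℚ γ = g) (hK₁ : ∀ g, g ∈ K₁ ↔ A * g * A⁻¹ ∈ K₀)
    {u : GL (Fin 2) ℚ} (hu : u ∈ K₁) : ∃ c ∈ K₁, c ∉ K₀ ∧ c * u ∉ K₀ := by
  obtain ⟨γu, hγu, rfl⟩ := (mem_iff_exists_conj hK₀ hK₁ u).mp hu
  let B₁ : SL(2, ℤ) := ⟨!![0, 1; -1, 0], by norm_num [Matrix.det_fin_two_of]⟩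
  let B₂ : SL(2, ℤ) := ⟨!![1, 1; 0, 1], by norm_num [Matrix.det_fin_two_of]⟩
  have hconj : ∀ γ : SL(2, ℤ), A⁻¹ * mapGL ℚ γ * A * (A⁻¹ * mapGL ℚ γu * A) =
      A⁻¹ * mapGL ℚ (γ * γu) * A := fun γ ↦ by rw [map_mul]; group
  by_cases h11 : (p : ℤ) ∣ γu 1 1
  · -- then `p ∤ u₀₁`; take `c ≡ [1, 1; 0, 1]`
    have h01 : ¬ (p : ℤ) ∣ γu 0 1 := by
      intro h01
      have hdet : γu 0 0 * γu 1 1 - γu 0 1 * γu 1 0 = 1 := by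
        have := Matrix.det_fin_two (γu : Matrix (Fin 2) (Fin 2) ℤ)
        rw [γu.det_coe] at this
        exact this.symm
      have : (p : ℤ) ∣ 1 := by
        rw [← hdet]; exact dvd_sub (Dvd.dvd.mul_left h11 _) (Dvd.dvd.mul_right h01 _)
      exact hp.ne_one (by exact_mod_cast Int.eq_one_of_dvd_one (by positivity) this)
    obtain ⟨γc, hγc, hcB⟩ := exists_mem_Gamma_forall_dvd_sub hNp B₂
    have hc01 : ¬ (p : ℤ) ∣ γc 0 1 :=
      not_dvd_of_dvd_sub_one hp (by simpa [B₂] using hcB 0 1)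
    refine ⟨A⁻¹ * mapGL ℚ γc * A, (mem_iff_exists_conj hK₀ hK₁ _).mpr ⟨γc, hγc, rfl⟩, ?_, ?_⟩
    · rwa [conj_mapGL_mem_iff_dvd hNp hA hK₀ hγc]
    · rw [hconj, conj_mapGL_mem_iff_dvd hNp hA hK₀ (Subgroup.mul_mem _ hγc hγu),
        not_dvd_iff_cast_ne_zero, cast_mul_apply, cast_eq_of_dvd_sub hcB, cast_eq_of_dvd_sub hcB]
      have h01' : (γu 0 1 : ZMod p) ≠ 0 := not_dvd_iff_cast_ne_zero.mp h01
      have h11' : (γu 1 1 : ZMod p) = 0 := (ZMod.intCast_zmod_eq_zero_iff_dvd _ p).mpr h11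
      simpa [B₂, h11'] using h01'
  · obtain ⟨γc, hγc, hcB⟩ := exists_mem_Gamma_forall_dvd_sub hNp B₁
    have hc01 : ¬ (p : ℤ) ∣ γc 0 1 :=
      not_dvd_of_dvd_sub_one hp (by simpa [B₁] using hcB 0 1)
    refine ⟨A⁻¹ * mapGL ℚ γc * A, (mem_iff_exists_conj hK₀ hK₁ _).mpr ⟨γc, hγc, rfl⟩, ?_, ?_⟩
    · rwa [conj_mapGL_mem_iff_dvd hNp hA hK₀ hγc]
    · rw [hconj, conj_mapGL_mem_iff_dvd hNp hA hK₀ (Subgroup.mul_mem _ hγc hγu),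
        not_dvd_iff_cast_ne_zero, cast_mul_apply, cast_eq_of_dvd_sub hcB, cast_eq_of_dvd_sub hcB]
      have h11' : (γu 1 1 : ZMod p) ≠ 0 := not_dvd_iff_cast_ne_zero.mp h11
      simpa [B₁] using h11'

/-- **Ihara's theorem, injectivity half: `Γ(N)` and `A⁻¹ Γ(N) A` generate their amalgam over
`Γ(N) ∩ Γ₀(p)` inside `GL₂(ℚ)`.** Every non-empty reduced alternating word in `K₀ = Γ(N)` and
`K₁ = A⁻¹ Γ(N) A` (letters from `K_i ∖ K_{1-i}`, consecutive letters from different factors) has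
product `≠ 1`; proved by ping-pong on `ℙ¹(ℚ)` with the `p`-integral points versus their
complement (the two half-trees of the Bruhat–Tits tree of `SL₂(ℚ_p)` at the edge `Γ₀(p)`).
[cite: Serre1980Trees, II.1.4 Thm. 3 and Cor. 1; I.4.1 Thm. 6] -/
theorem prod_ne_one_of_reduced [Fact p.Prime] (hNp : N.Coprime p)
    (hA : (A : Matrix (Fin 2) (Fin 2) ℚ) = !![(p : ℚ), 0; 0, 1])
    (hK₀ : ∀ g, g ∈ K₀ ↔ ∃ γ ∈ Gamma N, mapGL ℚ γ = g) (hK₁ : ∀ g, g ∈ K₁ ↔ A * g * A⁻¹ ∈ K₀)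
    (l : List (Bool × GL (Fin 2) ℚ)) (hl : l ≠ [])
    (hK : ∀ x ∈ l, x.2 ∈ cond x.1 K₁ K₀ ∧ x.2 ∉ cond x.1 K₀ K₁)
    (hc : l.IsChain (fun x y => x.1 ≠ y.1)) : (l.map Prod.snd).prod ≠ 1 := by
  have hp : p.Prime := Fact.out
  -- the `p`-integral points of `ℙ¹(ℚ)`
  let X : Set (OnePoint ℚ) := {z | ∃ t : ℚ, z = t ∧ 0 ≤ padicValRat p t}
  have hX : ∀ z, z ∈ X ↔ ∃ t : ℚ, z = t ∧ 0 ≤ padicValRat p t := fun z ↦ Iff.rfl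
  refine pingPong_prod_ne_one (fun b ↦ cond b K₁ K₀) (fun b ↦ cond b Xᶜ X) ?_ ?_ ?_ ?_ l hl ?_ hc
  · -- ping and pong
    rintro (_ | _) g hg hg' z hz
    · -- `g ∈ K₀ ∖ K₁`
      simp only [cond_false, Bool.not_false, cond_true] at hg hg' hz ⊢
      obtain ⟨γ, hγ, rfl⟩ := (hK₀ g).mp hg
      rw [mapGL_mem_iff_dvd hNp hA hK₀ hK₁ hγ] at hg'
      exact mapGL_smul_mem_of_not_dvd X hX hg' hz
    · -- `g ∈ K₁ ∖ K₀`
      simp only [cond_true, Bool.not_true, cond_false] at hg hg' hz ⊢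
      obtain ⟨γ, hγ, rfl⟩ := (mem_iff_exists_conj hK₀ hK₁ g).mp hg
      rw [conj_mapGL_mem_iff_dvd hNp hA hK₀ hγ] at hg'
      exact conj_mapGL_smul_not_mem_of_not_dvd X hX hA hg' hz
  · simpa using disjoint_compl_right
  · rintro (_ | _)
    · exact ⟨((0 : ℚ) : OnePoint ℚ), (hX _).mpr ⟨0, rfl, by rw [padicValRat.zero]⟩⟩
    · refine ⟨∞, ?_⟩
      simp only [cond_true, Set.mem_compl_iff, hX, not_exists, not_and]
      exact fun t ht ↦ absurd ht (OnePoint.infty_ne_coe t)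
  · rintro (_ | _) u hu
    · simpa using exists_mul_not_mem_right hp hNp hA hK₀ hK₁ (by simpa using hu)
    · simpa using exists_mul_not_mem_left hp hNp hA hK₀ hK₁ (by simpa using hu)
  · intro x hx
    obtain ⟨h1, h2⟩ := hK x hx
    refine ⟨h1, ?_⟩
    cases hx1 : x.1 <;> simp_all

end Amalgam

end IharaAmalgam

end Literature.GroupTheory.ArithmeticGroups
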